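import Summits.Ventures.CertifiedManyBodySolver.Downfold.EmeryScaleBoxRule
import HarnessLib

/-!
# THE TRUE-CORNER BOX RULE FOR THE SCALE COORDINATE, CELL-WISE `t_pp′` STEP: the fixed-energy `t_pp′` comparison is checked on each Δ-cell of the chain
# with that cell's certified Fermi-energy window (instead of one box-wide window) — `box_upper_cells` / `box_lower_cells` (INFL-3to1-B §B.88 (v′))

Venture CertifiedManyBodySolver, cell `pub/hubbard-downfold` (stage S1; INFLATION-RULES-3to1-B §B.88), seat hubbard-downfold-mod-4 (technique B = band
level, g36); namespace `Summit.Ventures.CertifiedManyBodySolver.Downfold.Emery`. Everything PROVED (0 sorry). WHAT THIS IS NOT: a statement about any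
material; no number lives here; `U = 0` one-body kinematics of the σ model.

`EmeryScaleBoxRule.box_upper` checks the `t_pp′` leaf on ONE box × energy window `⊇ [ε_F(Δ₂, a₁, b₁, c₂), ε_F(Δ₁, a₂, b₂, c₂)]`; on a wide box that window
pairs low energies with low Δ (never realised) where the certificate needs huge depth. Here the leaf is checked per Δ-cell of the chain data
(`cStepCheckUpper/Lower`: the cell's own output window `Wout` ∋ the member's Fermi energy, its `(Δ, t_pd, t_pp)` ranges), and `chain_upper_cstep` /
`chain_lower_cstep` walk the chain to the member's cell. `box_upper_cells` / `box_lower_cells` are `box_upper` / `box_lower` with this step.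

Sources: three-band model [HybertsenSchluterChristensen1989, Eq. (1)]; energy-linearised one-band image [AndersenEtAl1995, §6]; interval arithmetic
[folklore] (Moore 1966).
-/

noncomputable section

namespace Summit.Ventures.CertifiedManyBodySolver.Downfold.Emery

open Real Set Literature.Analysis.ValidatedNumerics.Numerics

/-! ## §1 Cell-wise `t_pp′` checks and the chain walk -/

/-- Per-Δ-cell `t_pp′` leaf, ceiling side: base `cP`, direction `+1`, on `(famOf ID1 c.iS (+1), famOf IA2 na.iS (−1), famOf IB2 nb.iS (−1)) × [0, wC] × (c.Wout ∩ [whlo, ∞))`. [folklore] -/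
def cStepCheckUpper (cP : FI) (nC : ℕ) (ID1 IA2 IB2 : FI) (wC whlo : ℤ) (nodes : List ANode) : Bool :=
  nodes.all fun na => na.sub.all fun nb => nb.sub.all fun c =>
    SBox.deep (cLeaf true cP (thin (SC : ℤ))) nC
      ⟨famOf ID1 c.iS (thin (SC : ℤ)), famOf IA2 na.cell.iS (thin (-(SC : ℤ))), famOf IB2 nb.cell.iS (thin (-(SC : ℤ))), ⟨0, wC⟩,
        ⟨max c.Wout.lo whlo, c.Wout.hi⟩⟩

/-- Per-Δ-cell `t_pp′` leaf, floor side: base `cP`, direction `−1`. [folklore] -/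
def cStepCheckLower (cP : FI) (nC : ℕ) (ID2 IA1 IB1 : FI) (wC : ℤ) (nodes : List ANode) : Bool :=
  nodes.all fun na => na.sub.all fun nb => nb.sub.all fun c =>
    SBox.deep (cLeaf false cP (thin (-(SC : ℤ)))) nC
      ⟨famOf ID2 c.iS (thin (-(SC : ℤ))), famOf IA1 na.cell.iS (thin (SC : ℤ)), famOf IB1 nb.cell.iS (thin (SC : ℤ)), ⟨0, wC⟩, c.Wout⟩

section Chains

variable {cN cP W0 ID1 IA2 IB2 ID2 IA1 IB1 : FI} {whlo wA wB wD : ℤ} {nodes : List ANode} {cNr cPr ν Δ₁ a₂ b₂ Δ₂ a₁ b₁ : ℝ}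

/-- **Chain walk, UPPER**: under the chain data and the cell-wise `t_pp′` checks, for every member `(Δ, a, b)` and `0 ≤ sC ≤ wC/SC`:
`t((Δ, a, b, cP + sC); ε_F(Δ, a, b, cN)) ≤ t((Δ, a, b, cP); ε_F(Δ, a, b, cN))`. [folklore] -/
theorem chain_upper_cstep (h : chainCheckUpper cN cP whlo ID1 IA2 IB2 wA wB wD W0 nodes = true) {nC : ℕ} {wC : ℤ}
    (hcs : cStepCheckUpper cP nC ID1 IA2 IB2 wC whlo nodes = true) {sC : ℝ} (hsC0 : 0 ≤ sC) (hsCw : sC * SC ≤ (wC : ℝ)) (hcN : FI.mem cNr cN) (hcP : FI.mem cPr cP)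
    (hD1 : FI.mem Δ₁ ID1) (hA2 : FI.mem a₂ IA2) (hB2 : FI.mem b₂ IB2) (hν0 : 0 < ν) (hν1 : ν < 1) {Δ a b : ℝ} (hΔ1 : Δ₁ ≤ Δ)
    (hΔ2 : (Δ - Δ₁) * SC ≤ (wD : ℝ)) (ha1 : a ≤ a₂) (ha2 : (a₂ - a) * SC ≤ (wA : ℝ)) (hb1 : b ≤ b₂) (hb2 : (b₂ - b) * SC ≤ (wB : ℝ))
    (hW0 : FI.mem (fermiEnergyOf Δ₁ a₂ b₂ cNr ν) W0)
    (hcrude : ∀ Δ' a' b' : ℝ, Δ₁ ≤ Δ' → Δ' ≤ Δ → a ≤ a' → a' ≤ a₂ → b ≤ b' → b' ≤ b₂ → (whlo : ℝ) / SC ≤ fermiEnergyOf Δ' a' b' cNr ν) :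
    scaleNodeN Δ a b (cPr + sC * 1) (fermiEnergyOf Δ a b cNr ν) / scaleNodeD Δ a b (cPr + sC * 1) (fermiEnergyOf Δ a b cNr ν) ≤
      scaleNodeN Δ a b cPr (fermiEnergyOf Δ a b cNr ν) / scaleNodeD Δ a b cPr (fermiEnergyOf Δ a b cNr ν) := by
  obtain ⟨h1, hm1, h0⟩ := mem_dirs
  simp only [chainCheckUpper, Bool.and_eq_true] at h
  obtain ⟨hA, hrest⟩ := h
  -- stage A: a = a₂ + sA·(−1)
  set sA := a₂ - a with hsA
  have hsA0 : 0 ≤ sA := by rw [hsA]; linarith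
  have eA : a₂ + -sA = a := by rw [hsA]; ring
  have stA := stage_upper hA h0 hm1 h0 hcN hcP hν0 hν1 hD1 hA2 hB2 hsA0 ha2 hW0 (by
    simp only [mul_zero, add_zero, mul_neg, mul_one, eA]
    exact hcrude _ a _ le_rfl hΔ1 le_rfl ha1 hb1 le_rfl)
  simp only [mul_zero, add_zero, mul_neg, mul_one, eA] at stA
  obtain ⟨hTA, cA, hcA, hscA, hWA⟩ := stA
  obtain ⟨na, hna, rfl⟩ := List.mem_map.1 hcA
  have hB := (List.all_eq_true.1 hrest na hna)
  simp only [Bool.and_eq_true] at hB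
  obtain ⟨hB, hrestB⟩ := hB
  -- stage B: b = b₂ + sB·(−1)
  set sB := b₂ - b with hsB
  have hsB0 : 0 ≤ sB := by rw [hsB]; linarith
  have eB : b₂ + -sB = b := by rw [hsB]; ring
  have ma : FI.mem a (famOf IA2 na.cell.iS (thin (-(SC : ℤ)))) := by
    have := mem_famOf hA2 hscA hm1; simp only [mul_neg, mul_one, eA] at this; exact this
  have stB := stage_upper hB h0 h0 hm1 hcN hcP hν0 hν1 hD1 ma hB2 hsB0 hb2 hWA (by
    simp only [mul_zero, add_zero, mul_neg, mul_one, eB]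
    exact hcrude _ a b le_rfl hΔ1 le_rfl ha1 le_rfl hb1)
  simp only [mul_zero, add_zero, mul_neg, mul_one, eB] at stB
  obtain ⟨hTB, cB, hcB, hscB, hWB⟩ := stB
  obtain ⟨nb, hnb, rfl⟩ := List.mem_map.1 hcB
  have hC := List.all_eq_true.1 hrestB nb hnb
  -- stage C: Δ = Δ₁ + sD·1
  set sD := Δ - Δ₁ with hsD
  have hsD0 : 0 ≤ sD := by rw [hsD]; linarith
  have eD : Δ₁ + sD = Δ := by rw [hsD]; ring
  have mb : FI.mem b (famOf IB2 nb.cell.iS (thin (-(SC : ℤ)))) := by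
    have := mem_famOf hB2 hscB hm1; simp only [mul_neg, mul_one, eB] at this; exact this
  have stC := stage_upper hC h1 h0 h0 hcN hcP hν0 hν1 hD1 ma mb hsD0 hΔ2 hWB (by
    simp only [mul_zero, add_zero, mul_one, eD]
    exact hcrude Δ a b hΔ1 le_rfl le_rfl ha1 le_rfl hb1)
  simp only [mul_zero, add_zero, mul_one, eD] at stC
  obtain ⟨-, cC, hcC, hscC, hWC⟩ := stC
  -- the c-step box of the cell (na, nb, cC)
  simp only [cStepCheckUpper, List.all_eq_true] at hcs
  have hdeep := hcs na hna nb hnb cC hcC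
  have mD : FI.mem Δ (famOf ID1 cC.iS (thin (SC : ℤ))) := by
    have := mem_famOf hD1 hscC h1; simp only [mul_one, eD] at this; exact this
  have hfl := hcrude Δ a b hΔ1 le_rfl le_rfl ha1 le_rfl hb1
  have hWC' : FI.mem (fermiEnergyOf Δ a b cNr ν) ⟨max cC.Wout.lo whlo, cC.Wout.hi⟩ := by
    refine ⟨?_, hWC.2⟩
    have h2 : (whlo : ℝ) ≤ fermiEnergyOf Δ a b cNr ν * SC := (div_le_iff₀ SC_pos).1 hfl
    push_cast
    exact max_le hWC.1 h2
  exact SBox.forall_of_deep (cLeaf_upper_sound hcP h1) nC _ hdeep Δ a b sC _ ⟨mD, ma, mb, ⟨by simpa using mul_nonneg hsC0 SC_pos.le, hsCw⟩, hWC'⟩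

/-- **Chain walk, LOWER**: `t((Δ, a, b, cP); ε_F) ≤ t((Δ, a, b, cP − sC); ε_F)`. [folklore] -/
theorem chain_lower_cstep (h : chainCheckLower cN cP ID2 IA1 IB1 wA wB wD W0 nodes = true) {nC : ℕ} {wC : ℤ}
    (hcs : cStepCheckLower cP nC ID2 IA1 IB1 wC nodes = true) {sC : ℝ} (hsC0 : 0 ≤ sC) (hsCw : sC * SC ≤ (wC : ℝ)) (hcN : FI.mem cNr cN) (hcP : FI.mem cPr cP)
    (hD2 : FI.mem Δ₂ ID2) (hA1 : FI.mem a₁ IA1) (hB1 : FI.mem b₁ IB1) (hcN0 : 0 ≤ cNr) (hν0 : 0 < ν) (hν1 : ν < 1) {Δ a b : ℝ} (hΔpos : 0 < Δ)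
    (ha1pos : 0 < a₁) (hb1nn : 0 ≤ b₁) (hΔ1 : Δ ≤ Δ₂) (hΔ2 : (Δ₂ - Δ) * SC ≤ (wD : ℝ)) (ha1 : a₁ ≤ a) (ha2 : (a - a₁) * SC ≤ (wA : ℝ))
    (hb1 : b₁ ≤ b) (hb2 : (b - b₁) * SC ≤ (wB : ℝ)) (hW0 : FI.mem (fermiEnergyOf Δ₂ a₁ b₁ cNr ν) W0) :
    scaleNodeN Δ a b cPr (fermiEnergyOf Δ a b cNr ν) / scaleNodeD Δ a b cPr (fermiEnergyOf Δ a b cNr ν) ≤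
      scaleNodeN Δ a b (cPr + sC * (-1)) (fermiEnergyOf Δ a b cNr ν) / scaleNodeD Δ a b (cPr + sC * (-1)) (fermiEnergyOf Δ a b cNr ν) := by
  obtain ⟨h1, hm1, h0⟩ := mem_dirs
  have hΔ2pos : 0 < Δ₂ := lt_of_lt_of_le hΔpos hΔ1
  simp only [chainCheckLower, Bool.and_eq_true] at h
  obtain ⟨hA, hrest⟩ := h
  -- monotone law from the two-corner rule on degenerate boxes
  have mono : ∀ {D D' x x' y y' : ℝ}, 0 < D' → D' ≤ D → 0 < x → x ≤ x' → 0 ≤ y → y ≤ y' →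
      fermiEnergyOf D x y cNr ν ≤ fermiEnergyOf D' x' y' cNr ν := by
    intro D D' x x' y y' hD' hDD hx hxx hy hyy
    have := fermiEnergyOf_mem_Icc_of_mem_box' (Δ := D') (a := x') (b := y') (c := cNr) hD' hx hy hcN0 ⟨le_rfl, hDD⟩ ⟨hxx, le_rfl⟩ ⟨hyy, le_rfl⟩
      ⟨le_rfl, le_rfl⟩ hν0 hν1
    exact this.1
  -- stage A: a = a₁ + sA·1
  set sA := a - a₁ with hsA
  have hsA0 : 0 ≤ sA := by rw [hsA]; linarith
  have eA : a₁ + sA = a := by rw [hsA]; ring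
  have stA := stage_lower hA h0 h1 h0 hcN hcP hν0 hν1 hD2 hA1 hB1 hsA0 ha2 hW0 (by
    simp only [mul_zero, add_zero, mul_one, eA]
    exact mono hΔ2pos le_rfl ha1pos ha1 hb1nn le_rfl)
  simp only [mul_zero, add_zero, mul_one, eA] at stA
  obtain ⟨hTA, cA, hcA, hscA, hWA⟩ := stA
  obtain ⟨na, hna, rfl⟩ := List.mem_map.1 hcA
  have hB := (List.all_eq_true.1 hrest na hna)
  simp only [Bool.and_eq_true] at hB
  obtain ⟨hB, hrestB⟩ := hB
  -- stage B: b = b₁ + sB·1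
  set sB := b - b₁ with hsB
  have hsB0 : 0 ≤ sB := by rw [hsB]; linarith
  have eB : b₁ + sB = b := by rw [hsB]; ring
  have hapos : 0 < a := lt_of_lt_of_le ha1pos ha1
  have ma : FI.mem a (famOf IA1 na.cell.iS (thin (SC : ℤ))) := by
    have := mem_famOf hA1 hscA h1; simp only [mul_one, eA] at this; exact this
  have stB := stage_lower hB h0 h0 h1 hcN hcP hν0 hν1 hD2 ma hB1 hsB0 hb2 hWA (by
    simp only [mul_zero, add_zero, mul_one, eB]
    exact mono hΔ2pos le_rfl hapos le_rfl hb1nn hb1)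
  simp only [mul_zero, add_zero, mul_one, eB] at stB
  obtain ⟨hTB, cB, hcB, hscB, hWB⟩ := stB
  obtain ⟨nb, hnb, rfl⟩ := List.mem_map.1 hcB
  have hC := List.all_eq_true.1 hrestB nb hnb
  -- stage C: Δ = Δ₂ + sD·(−1)
  set sD := Δ₂ - Δ with hsD
  have hsD0 : 0 ≤ sD := by rw [hsD]; linarith
  have eD : Δ₂ + -sD = Δ := by rw [hsD]; ring
  have hbnn : 0 ≤ b := le_trans hb1nn hb1
  have mb : FI.mem b (famOf IB1 nb.cell.iS (thin (SC : ℤ))) := by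
    have := mem_famOf hB1 hscB h1; simp only [mul_one, eB] at this; exact this
  have stC := stage_lower hC hm1 h0 h0 hcN hcP hν0 hν1 hD2 ma mb hsD0 hΔ2 hWB (by
    simp only [mul_zero, add_zero, mul_neg, mul_one, eD]
    exact mono hΔpos hΔ1 hapos le_rfl hbnn le_rfl)
  simp only [mul_zero, add_zero, mul_neg, mul_one, eD] at stC
  obtain ⟨-, cC, hcC, hscC, hWC⟩ := stC
  simp only [cStepCheckLower, List.all_eq_true] at hcs
  have hdeep := hcs na hna nb hnb cC hcC
  have mD : FI.mem Δ (famOf ID2 cC.iS (thin (-(SC : ℤ)))) := by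
    have := mem_famOf hD2 hscC hm1; simp only [mul_neg, mul_one, eD] at this; exact this
  exact SBox.forall_of_deep (cLeaf_lower_sound hcP hm1) nC _ hdeep Δ a b sC _ ⟨mD, ma, mb, ⟨by simpa using mul_nonneg hsC0 SC_pos.le, hsCw⟩, hWC⟩

end Chains

/-! ## §2 The box theorems, cell-wise `t_pp′` step -/

section Box

variable {cN cP W0 ID1 IA2 IB2 ID2 IA1 IB1 : FI} {whlo wA wB wD wC : ℤ} {nodes : List ANode} {nC : ℕ}
  {ν Δ₁ Δ₂ a₁ a₂ b₁ b₂ c₁ c₂ p : ℝ}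

/-- **THE BOX THEOREM, UPPER SIDE (cell-wise `t_pp′` step).** As `box_upper` with `cStepCheckUpper` in place of the box-wide leaf. [folklore] -/
theorem box_upper_cells (hchain : chainCheckUpper cN cP whlo ID1 IA2 IB2 wA wB wD W0 nodes = true)
    (hc : cStepCheckUpper cP nC ID1 IA2 IB2 wC whlo nodes = true)
    (hcN : FI.mem c₂ cN) (hcP : FI.mem c₁ cP) (hD1 : FI.mem Δ₁ ID1) (hA2 : FI.mem a₂ IA2) (hB2 : FI.mem b₂ IB2) (hν0 : 0 < ν) (hν1 : ν < 1)
    (hΔ₁ : 0 < Δ₁) (ha₁ : 0 < a₁) (hc₁ : 0 ≤ c₁) (hc12 : c₁ ≤ c₂) (hcb : c₂ ≤ b₁) (hwD : (Δ₂ - Δ₁) * SC ≤ (wD : ℝ)) (hwA : (a₂ - a₁) * SC ≤ (wA : ℝ))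
    (hwB : (b₂ - b₁) * SC ≤ (wB : ℝ)) (hwC : (c₂ - c₁) * SC ≤ (wC : ℝ)) (hW0 : FI.mem (fermiEnergyOf Δ₁ a₂ b₂ c₂ ν) W0)
    (hwhlo : (whlo : ℝ) / SC ≤ fermiEnergyOf Δ₂ a₁ b₁ c₂ ν)
    (hregm : c₂ * fermiEnergyOf Δ₁ a₂ b₂ c₁ ν < a₁ ^ 2) (hregq : b₂ * Δ₂ < 4 * a₁ ^ 2) (hp : p ≤ fermiEnergyOf Δ₁ a₂ b₂ c₂ ν) (hp0 : 0 < p)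
    {Δ a b c : ℝ} (hΔ : Δ ∈ Icc Δ₁ Δ₂) (ha : a ∈ Icc a₁ a₂) (hb : b ∈ Icc b₁ b₂) (hcc : c ∈ Icc c₁ c₂) :
    scaleT Δ a b c (xNode Δ a b c (fermiEnergyOf Δ a b c ν)) (xNode Δ a b c (fermiEnergyOf Δ a b c ν)) (fermiEnergyOf Δ a b c ν) ≤
      scaleNodeN Δ₁ a₂ b₂ c₁ p / scaleNodeD Δ₁ a₂ b₂ c₁ p := by
  have hΔ0 : 0 < Δ := lt_of_lt_of_le hΔ₁ hΔ.1
  have ha0 : 0 < a := lt_of_lt_of_le ha₁ ha.1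
  have hc0 : 0 ≤ c := hc₁.trans hcc.1
  have hcb' : c ≤ b := (hcc.2.trans hcb).trans hb.1
  have hc₂0 : 0 ≤ c₂ := hc₁.trans hc12
  have hb0 : 0 ≤ b := hc0.trans hcb'
  set E := fermiEnergyOf Δ a b c ν with hE
  set E₂ := fermiEnergyOf Δ a b c₂ ν with hE₂
  have hE0 : 0 < E := fermiEnergyOf_pos hΔ0 ha0.ne' hc0 hb0 hν0 hν1
  have hE₂0 : 0 < E₂ := fermiEnergyOf_pos hΔ0 ha0.ne' hc₂0 hb0 hν0 hν1
  -- ε_F is antitone in t_pp′ and monotone in the box (two-corner rule)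
  have hEE₂ : E₂ ≤ E := (fermiEnergyOf_mem_Icc_of_mem_box' (Δ₁ := Δ) (Δ₂ := Δ) (a₁ := a) (a₂ := a) (b₁ := b) (b₂ := b) (c₁ := c) (c₂ := c₂)
    hΔ0 ha0 hb0 hc0 ⟨le_rfl, le_rfl⟩ ⟨le_rfl, le_rfl⟩ ⟨le_rfl, le_rfl⟩ ⟨le_rfl, hcc.2⟩ hν0 hν1).1
  have hEtop : E ≤ fermiEnergyOf Δ₁ a₂ b₂ c₁ ν := (fermiEnergyOf_mem_Icc_of_mem_box' hΔ₁ ha₁ (hc₂0.trans hcb) hc₁ hΔ ha hb hcc hν0 hν1).2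
  have hE₂win : fermiEnergyOf Δ₂ a₁ b₁ c₂ ν ≤ E₂ ∧ E₂ ≤ fermiEnergyOf Δ₁ a₂ b₂ c₂ ν :=
    fermiEnergyOf_mem_Icc_of_mem_box' hΔ₁ ha₁ (hc₂0.trans hcb) hc₂0 hΔ ha hb ⟨le_rfl, le_rfl⟩ hν0 hν1
  -- (1) closed form and energy antitonicity at θ: t(θ; E) ≤ t(θ; E₂)
  rw [scaleT_node_eq (by linarith) hE0.le hc0 hcb' ha0.ne']
  have hm : c * E < a ^ 2 := by
    have h1 : c * E ≤ c₂ * fermiEnergyOf Δ₁ a₂ b₂ c₁ ν := mul_le_mul hcc.2 hEtop hE0.le hc₂0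
    have h2 : a₁ ^ 2 ≤ a ^ 2 := by nlinarith [ha.1]
    linarith
  have hq : b * Δ < 4 * a ^ 2 := by
    have h1 : b * Δ ≤ b₂ * Δ₂ := mul_le_mul hb.2 hΔ.2 hΔ0.le (hb0.trans hb.2)
    have h2 : a₁ ^ 2 ≤ a ^ 2 := by nlinarith [ha.1]
    linarith
  have step1 := scaleNode_div_antitone hΔ0 hc0 hcb' ha0.ne' hE₂0 hEE₂ hm hq
  -- (2) the t_pp′ step at fixed energy E₂, on the chain cell of (Δ, a, b): t((Δ,a,b,c); E₂) ≤ t((Δ,a,b,c₁); E₂)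
  have hcrude : ∀ Δ' a' b' : ℝ, Δ₁ ≤ Δ' → Δ' ≤ Δ → a ≤ a' → a' ≤ a₂ → b ≤ b' → b' ≤ b₂ → (whlo : ℝ) / SC ≤ fermiEnergyOf Δ' a' b' c₂ ν := by
    intro Δ' a' b' h1' h2' h3' h4' h5' h6'
    exact hwhlo.trans (fermiEnergyOf_mem_Icc_of_mem_box' hΔ₁ ha₁ (hc₂0.trans hcb) hc₂0 ⟨h1', h2'.trans hΔ.2⟩ ⟨ha.1.trans h3', h4'⟩
      ⟨hb.1.trans h5', h6'⟩ ⟨le_rfl, le_rfl⟩ hν0 hν1).1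
  have hwD' : (Δ - Δ₁) * SC ≤ (wD : ℝ) := le_trans (mul_le_mul_of_nonneg_right (by linarith [hΔ.2]) SC_pos.le) hwD
  have hwA' : (a₂ - a) * SC ≤ (wA : ℝ) := le_trans (mul_le_mul_of_nonneg_right (by linarith [ha.1]) SC_pos.le) hwA
  have hwB' : (b₂ - b) * SC ≤ (wB : ℝ) := le_trans (mul_le_mul_of_nonneg_right (by linarith [hb.1]) SC_pos.le) hwB
  have hsC : (c - c₁) * SC ≤ (wC : ℝ) := le_trans (mul_le_mul_of_nonneg_right (by linarith [hcc.2]) SC_pos.le) hwC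
  have step2 := chain_upper_cstep hchain hc (sub_nonneg.2 hcc.1) hsC hcN hcP hD1 hA2 hB2 hν0 hν1 hΔ.1 hwD' ha.2 hwA' hb.2 hwB' hW0 hcrude
  simp only [mul_one, add_sub_cancel] at step2
  -- (3) the chain on the c₁-hopping / c₂-energy rows
  have step3 := chain_upper hchain hcN hcP hD1 hA2 hB2 hν0 hν1 hΔ.1 hwD' ha.2 hwA' hb.2 hwB' hW0 hcrude
  -- (4) the corner at its bracket floor p
  have hmV : c₁ * fermiEnergyOf Δ₁ a₂ b₂ c₂ ν < a₂ ^ 2 := by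
    have h1 : c₁ * fermiEnergyOf Δ₁ a₂ b₂ c₂ ν ≤ c₂ * fermiEnergyOf Δ₁ a₂ b₂ c₁ ν := by
      refine mul_le_mul hc12 ?_ (fermiEnergyOf_pos hΔ₁ (lt_of_lt_of_le ha₁ (ha.1.trans ha.2)).ne' hc₂0 (hc₂0.trans (hcb.trans (hb.1.trans hb.2))) hν0 hν1).le hc₂0
      exact (fermiEnergyOf_mem_Icc_of_mem_box' hΔ₁ ha₁ (hc₂0.trans hcb) hc₁ (Δ := Δ₁) (a := a₂) (b := b₂) (c := c₂) ⟨le_rfl, hΔ.1.trans hΔ.2⟩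
        ⟨ha.1.trans ha.2, le_rfl⟩ ⟨hb.1.trans hb.2, le_rfl⟩ ⟨hc12, le_rfl⟩ hν0 hν1).2
    have h2 : a₁ ^ 2 ≤ a₂ ^ 2 := by nlinarith [ha.1.trans ha.2]
    linarith
  have hqV : b₂ * Δ₁ < 4 * a₂ ^ 2 := by
    have h1 : b₂ * Δ₁ ≤ b₂ * Δ₂ := mul_le_mul_of_nonneg_left (hΔ.1.trans hΔ.2) (hb0.trans hb.2)
    have h2 : a₁ ^ 2 ≤ a₂ ^ 2 := by nlinarith [ha.1.trans ha.2]
    linarith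
  have step4 := scaleNode_div_antitone hΔ₁ hc₁ (hc12.trans (hcb.trans (hb.1.trans hb.2))) (lt_of_lt_of_le ha₁ (ha.1.trans ha.2)).ne' hp0 hp hmV hqV
  exact step1.trans (step2.trans (step3.trans step4))

/-- **THE BOX THEOREM, LOWER SIDE (cell-wise `t_pp′` step).** [folklore] -/
theorem box_lower_cells (hchain : chainCheckLower cN cP ID2 IA1 IB1 wA wB wD W0 nodes = true)
    (hc : cStepCheckLower cP nC ID2 IA1 IB1 wC nodes = true)
    (hcN : FI.mem c₁ cN) (hcP : FI.mem c₂ cP) (hD2 : FI.mem Δ₂ ID2) (hA1 : FI.mem a₁ IA1) (hB1 : FI.mem b₁ IB1) (hν0 : 0 < ν) (hν1 : ν < 1)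
    (hΔ₁ : 0 < Δ₁) (ha₁ : 0 < a₁) (hc₁ : 0 ≤ c₁) (hc12 : c₁ ≤ c₂) (hcb : c₂ ≤ b₁) (hwD : (Δ₂ - Δ₁) * SC ≤ (wD : ℝ)) (hwA : (a₂ - a₁) * SC ≤ (wA : ℝ))
    (hwB : (b₂ - b₁) * SC ≤ (wB : ℝ)) (hwC : (c₂ - c₁) * SC ≤ (wC : ℝ)) (hW0 : FI.mem (fermiEnergyOf Δ₂ a₁ b₁ c₁ ν) W0)
    (hregm : c₂ * fermiEnergyOf Δ₁ a₂ b₂ c₁ ν < a₁ ^ 2) (hregq : b₂ * Δ₂ < 4 * a₁ ^ 2) {q : ℝ} (hq : fermiEnergyOf Δ₂ a₁ b₁ c₁ ν ≤ q)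
    (hqreg : c₂ * q < a₁ ^ 2) {Δ a b c : ℝ} (hΔ : Δ ∈ Icc Δ₁ Δ₂) (ha : a ∈ Icc a₁ a₂) (hb : b ∈ Icc b₁ b₂) (hcc : c ∈ Icc c₁ c₂) :
    scaleNodeN Δ₂ a₁ b₁ c₂ q / scaleNodeD Δ₂ a₁ b₁ c₂ q ≤
      scaleT Δ a b c (xNode Δ a b c (fermiEnergyOf Δ a b c ν)) (xNode Δ a b c (fermiEnergyOf Δ a b c ν)) (fermiEnergyOf Δ a b c ν) := by
  have hΔ0 : 0 < Δ := lt_of_lt_of_le hΔ₁ hΔ.1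
  have hΔ₂ : 0 < Δ₂ := lt_of_lt_of_le hΔ0 hΔ.2
  have ha0 : 0 < a := lt_of_lt_of_le ha₁ ha.1
  have hc0 : 0 ≤ c := hc₁.trans hcc.1
  have hc₂0 : 0 ≤ c₂ := hc₁.trans hc12
  have hcb' : c ≤ b := (hcc.2.trans hcb).trans hb.1
  have hb₁0 : 0 ≤ b₁ := hc₂0.trans hcb
  have hb0 : 0 ≤ b := hb₁0.trans hb.1
  set E := fermiEnergyOf Δ a b c ν with hE
  set E₁ := fermiEnergyOf Δ a b c₁ ν with hE₁
  have hE0 : 0 < E := fermiEnergyOf_pos hΔ0 ha0.ne' hc0 hb0 hν0 hν1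
  have hEE₁ : E ≤ E₁ := (fermiEnergyOf_mem_Icc_of_mem_box' (Δ₁ := Δ) (Δ₂ := Δ) (a₁ := a) (a₂ := a) (b₁ := b) (b₂ := b) (c₁ := c₁) (c₂ := c)
    hΔ0 ha0 hb0 hc₁ ⟨le_rfl, le_rfl⟩ ⟨le_rfl, le_rfl⟩ ⟨le_rfl, le_rfl⟩ ⟨hcc.1, le_rfl⟩ hν0 hν1).2
  have hE₁win : fermiEnergyOf Δ₂ a₁ b₁ c₁ ν ≤ E₁ ∧ E₁ ≤ fermiEnergyOf Δ₁ a₂ b₂ c₁ ν :=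
    fermiEnergyOf_mem_Icc_of_mem_box' hΔ₁ ha₁ hb₁0 hc₁ hΔ ha hb ⟨le_rfl, le_rfl⟩ hν0 hν1
  -- (1) closed form and antitonicity at θ: t(θ; E₁) ≤ t(θ; E)
  rw [scaleT_node_eq (by linarith) hE0.le hc0 hcb' ha0.ne']
  have hm : c * E₁ < a ^ 2 := by
    have h1 : c * E₁ ≤ c₂ * fermiEnergyOf Δ₁ a₂ b₂ c₁ ν := mul_le_mul hcc.2 hE₁win.2 (hE0.le.trans hEE₁) hc₂0
    have h2 : a₁ ^ 2 ≤ a ^ 2 := by nlinarith [ha.1]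
    linarith
  have hqq : b * Δ < 4 * a ^ 2 := by
    have h1 : b * Δ ≤ b₂ * Δ₂ := mul_le_mul hb.2 hΔ.2 hΔ0.le (hb0.trans hb.2)
    have h2 : a₁ ^ 2 ≤ a ^ 2 := by nlinarith [ha.1]
    linarith
  have step1 := scaleNode_div_antitone hΔ0 hc0 hcb' ha0.ne' hE0 hEE₁ hm hqq
  -- (2) the t_pp′ step at fixed energy E₁ on the chain cell: t((Δ,a,b,c₂); E₁) ≤ t((Δ,a,b,c); E₁), with c = c₂ + (c₂ − c)(−1)
  have hwD' : (Δ₂ - Δ) * SC ≤ (wD : ℝ) := le_trans (mul_le_mul_of_nonneg_right (by linarith [hΔ.1]) SC_pos.le) hwD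
  have hwA' : (a - a₁) * SC ≤ (wA : ℝ) := le_trans (mul_le_mul_of_nonneg_right (by linarith [ha.2]) SC_pos.le) hwA
  have hwB' : (b - b₁) * SC ≤ (wB : ℝ) := le_trans (mul_le_mul_of_nonneg_right (by linarith [hb.2]) SC_pos.le) hwB
  have hsC : (c₂ - c) * SC ≤ (wC : ℝ) := le_trans (mul_le_mul_of_nonneg_right (by linarith [hcc.1]) SC_pos.le) hwC
  have step2 := chain_lower_cstep hchain hc (sub_nonneg.2 hcc.2) hsC hcN hcP hD2 hA1 hB1 hc₁ hν0 hν1 hΔ0 ha₁ hb₁0 hΔ.2 hwD' ha.1 hwA' hb.1 hwB' hW0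
  have ec : c₂ + (c₂ - c) * (-1) = c := by ring
  rw [ec] at step2
  -- (3) the chain on the c₂-hopping / c₁-energy rows
  have step3 := chain_lower hchain hcN hcP hD2 hA1 hB1 hc₁ hν0 hν1 hΔ0 ha₁ hb₁0 hΔ.2 hwD' ha.1 hwA' hb.1 hwB' hW0
  -- (4) the corner above its bracket ceiling q
  have hΛ0 : 0 < fermiEnergyOf Δ₂ a₁ b₁ c₁ ν := fermiEnergyOf_pos hΔ₂ ha₁.ne' hc₁ hb₁0 hν0 hν1
  have hqV : b₁ * Δ₂ < 4 * a₁ ^ 2 := by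
    have h1 : b₁ * Δ₂ ≤ b₂ * Δ₂ := mul_le_mul_of_nonneg_right (hb.1.trans hb.2) hΔ₂.le
    linarith
  have step4 := scaleNode_div_antitone hΔ₂ hc₂0 hcb ha₁.ne' hΛ0 hq hqreg hqV
  exact step4.trans (step3.trans (step2.trans step1))

end Box

end Summit.Ventures.CertifiedManyBodySolver.Downfold.Emery
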